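import Mathlib.Algebra.BigOperators.Finsupp.Basic
import Literature.AnabelianGeometry.AbsoluteAnabelian.Sections
import Literature.AnabelianGeometry.AbsoluteAnabelian.AbsTopIII.CurveModel
import Literature.AnabelianGeometry.AbsoluteAnabelian.AbsTopIII.KummerFaithful
import HarnessLib

/-!
# [AbsTopIII] Prop. 1.6 (ii): sections of divisors in `Π_{J¹} = Π_X/[Δ_X, Δ_X]` and principal divisors

Mochizuki, *Topics in Absolute Anabelian Geometry III*, §1, Prop. 1.6 (ii), manuscript pp. 34–35
(lit key `paper:url-5493eb38cbb7`).  Setting (p. 34): "let us write `J^d → Spec(k)` for the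
connected component of the Picard scheme of `X → Spec(k)` that parametrizes line bundles of degree
`d` [...]; `J := J⁰`; `Π_{J^d} := π₁(J^d)`. [Thus, we have a natural morphism `X → J¹` [...]; this
morphism induces a surjection `Π_X ↠ Π_{J¹}` on étale fundamental groups whose kernel is equal to
the commutator subgroup of `Δ_X`.]"  Statement (p. 35): "(ii) For `x ∈ X(k)`, write
`s_x : G_k → Π_X` for the associated section [well-defined up to conjugation by `Δ_X`],
`t_x : G_k → Π_{J¹}` for the composite of `s_x` with the natural surjection `Π_X ↠ Π_{J¹}`.  Then for
any divisor `D` of degree `d` on `X` such that `Supp(D) ⊆ X(k)`, forming the appropriate `ℤ`-linear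
combination of '`t_x`'s' for `x ∈ Supp(D)` [...] yields a section `t_D : G_k → Π_{J^d}`; if,
moreover, `d = 0`, then `t_D : G_k → Π_J` coincides [up to conjugation by `Δ_X`] with the section
determined by the identity element `∈ J(k)` if and only if the divisor `D` is principal."

## How it is typed

The group-theoretic side is REAL over an abstract extension `E`:
* `PiJ1 E := Π / [Δ, Δ]⁻` (the bracketed description of `Π_{J¹}`), its augmentation `augJ1`, and the
  abelian normal subgroup `geomAbelianized E = Δ^ab ⊆ Π_{J¹}`;
* `sectionJ1 E s = t_x` for a section `s = s_x` (`Sections.lean`); the difference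
  `sectionDiff s t : G → Δ^ab`, `σ ↦ t_s(σ) t_t(σ)⁻¹`;
* the "`ℤ`-linear combination of `t_x`'s" for `d = 0` is typed through its COCYCLE relative to a base
  section `s₀`: `divisorCocycle n s s₀ (σ) = ∏_i (t_{x_i}(σ) t₀(σ)⁻¹)^{n_i} ∈ Δ^ab` (for `Σ n_i = 0`
  this function does not depend on `s₀`), and "`t_D` coincides up to conjugation by `Δ_X` with the
  identity section" becomes `IsPrincipalCocycle s₀ c`: `c(σ) = a · (t₀(σ) a t₀(σ)⁻¹)⁻¹` for some
  `a ∈ Δ^ab` (sections of an extension with abelian kernel ↔ `H¹`-torsor; the identity section of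
  `Π_J` corresponds to the class `0`).
  -- TODO(general form): the sections `t_D : G_k → Π_{J^d}` for `d ≠ 0` (Baer multiples of the
  extension `Π_{J¹}`) are not typed; only the `d = 0` criterion is.
The comparison with geometry is a NAMED FACT relative to a model `M : DivisorCurveModel` (a
`CurveModel` extended by rational points with their sections `s_x`, and the orders `ord_x` of rational
functions at closed points, from which "principal" is DEFINED) — typing policy θ of the abc-iut cell.
-/

noncomputable section

open scoped Classical Pointwise IsMulCommutative

namespace Literature.AnabelianGeometry.AbsoluteAnabelian.AbsTopIII

universe u

/-! ### `Π_{J¹} = Π/[Δ, Δ]⁻` and `Δ^ab` -/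

section Jacobian

variable (E : FundamentalExtension.{u})

/-- `[Δ_X, Δ_X]⁻`, the closure of the commutator subgroup of `Δ` inside `Π` ("whose kernel is equal to
the commutator subgroup of `Δ_X`", p. 34; closed since `Π_{J¹}` is profinite).
[cite: MochizukiAbsTopIII2015, Prop 1.6 p.34] -/
def geomCommutatorClosure : Subgroup E.arith := (⁅E.geom, E.geom⁆).topologicalClosure

/-- `[Δ, Δ]⁻` is normal in `Π`. [cite: MochizukiAbsTopIII2015, Prop 1.6 p.34] -/
instance geomCommutatorClosure_normal : (geomCommutatorClosure E).Normal := by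
  unfold geomCommutatorClosure
  exact Subgroup.is_normal_topologicalClosure _

/-- `[Δ, Δ]⁻ ≤ Δ`. [cite: MochizukiAbsTopIII2015, Prop 1.6 p.34] -/
theorem geomCommutatorClosure_le_geom : geomCommutatorClosure E ≤ E.geom :=
  Subgroup.topologicalClosure_minimal _ (Subgroup.commutator_le_left E.geom E.geom) E.isClosed_geom

/-- **`Π_{J¹} := Π_X/[Δ_X, Δ_X]⁻`** — the fundamental group of the degree-one Picard component as a
quotient of `Π_X` ("induces a surjection `Π_X ↠ Π_{J¹}` [...] whose kernel is equal to the commutator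
subgroup of `Δ_X`", p. 34). [cite: MochizukiAbsTopIII2015, Prop 1.6 p.34] -/
abbrev PiJ1 : Type u := E.arith ⧸ geomCommutatorClosure E

/-- The augmentation `Π_{J¹} → G` induced by `Π ↠ G` (`[Δ, Δ]⁻ ≤ Δ = Ker`).
[cite: MochizukiAbsTopIII2015, Prop 1.6 p.34] -/
def augJ1 : PiJ1 E →* E.gal :=
  QuotientGroup.lift _ E.aug.toMonoidHom (by
    rw [E.ker_aug]
    exact geomCommutatorClosure_le_geom E)

/-- `augJ1 [g] = aug g`. [cite: MochizukiAbsTopIII2015, Prop 1.6 p.34] -/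
@[simp] theorem augJ1_mk (g : E.arith) : augJ1 E (QuotientGroup.mk g) = E.aug g :=
  QuotientGroup.lift_mk _ _ _

/-- **`Δ_X^ab ⊆ Π_{J¹}`**: the image of `Δ` (the fundamental group "`T(J)`" side of
`1 → Δ^ab → Π_{J¹} → G_k → 1`). [cite: MochizukiAbsTopIII2015, Prop 1.6 p.34] -/
def geomAbelianized : Subgroup (PiJ1 E) := E.geom.map (QuotientGroup.mk' (geomCommutatorClosure E))

/-- `Δ^ab` is normal in `Π_{J¹}`. [cite: MochizukiAbsTopIII2015, Prop 1.6 p.34] -/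
instance geomAbelianized_normal : (geomAbelianized E).Normal :=
  Subgroup.Normal.map inferInstance _ (QuotientGroup.mk'_surjective _)

/-- `Δ^ab` is abelian. [cite: MochizukiAbsTopIII2015, Prop 1.6 p.34] -/
instance geomAbelianized_isMulCommutative : IsMulCommutative (geomAbelianized E) := by
  refine ⟨⟨fun a b => ?_⟩⟩
  obtain ⟨_, x, hx, rfl⟩ := a
  obtain ⟨_, y, hy, rfl⟩ := b
  apply Subtype.ext
  change (QuotientGroup.mk' _ x) * (QuotientGroup.mk' _ y) =
    (QuotientGroup.mk' _ y) * (QuotientGroup.mk' _ x)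
  rw [← map_mul, ← map_mul, QuotientGroup.mk'_apply, QuotientGroup.mk'_apply, QuotientGroup.eq]
  have hmem := Subgroup.commutator_mem_commutator (inv_mem hy) (inv_mem hx)
  rw [commutatorElement_def, inv_inv, inv_inv] at hmem
  have h : (x * y)⁻¹ * (y * x) = y⁻¹ * x⁻¹ * y * x := by
    simp only [mul_inv_rev, mul_assoc]
  rw [h]
  exact Subgroup.le_topologicalClosure _ hmem

/-- Membership in `Δ^ab` is detected by the augmentation. [cite: MochizukiAbsTopIII2015, Prop 1.6 p.34] -/
theorem mem_geomAbelianized_iff (y : PiJ1 E) : y ∈ geomAbelianized E ↔ augJ1 E y = 1 := by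
  induction y using QuotientGroup.induction_on with
  | H g =>
    rw [augJ1_mk]
    constructor
    · rintro ⟨x, hx, hxg⟩
      have : (QuotientGroup.mk x : PiJ1 E) = QuotientGroup.mk g := hxg
      rw [QuotientGroup.eq] at this
      have hg : g = x * (x⁻¹ * g) := by group
      rw [hg, map_mul, (E.mem_geom).mp hx, one_mul]
      exact (E.mem_geom).mp (geomCommutatorClosure_le_geom E this)
    · intro hg
      exact ⟨g, (E.mem_geom).mpr hg, rfl⟩

/-! ### Sections `t_x : G → Π_{J¹}` and the divisor cocycle -/

variable {E}

/-- "`t_x : G_k → Π_{J¹}` for the composite of `s_x` with the natural surjection `Π_X ↠ Π_{J¹}`"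
(p. 35), for a section `s = s_x`. [cite: MochizukiAbsTopIII2015, Prop 1.6 (ii) p.35] -/
def sectionJ1 (s : E.Section) : E.gal →* PiJ1 E :=
  (QuotientGroup.mk' (geomCommutatorClosure E)).comp s.toHom.toMonoidHom

/-- `t_x` is a section of `augJ1`. [cite: MochizukiAbsTopIII2015, Prop 1.6 (ii) p.35] -/
@[simp] theorem augJ1_sectionJ1 (s : E.Section) (σ : E.gal) : augJ1 E (sectionJ1 s σ) = σ := by
  change augJ1 E (QuotientGroup.mk (s.toHom σ)) = σ
  rw [augJ1_mk, s.aug_toHom]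

/-- The difference of two sections, `σ ↦ t_s(σ) · t_t(σ)⁻¹ ∈ Δ^ab` (a `1`-cocycle of `G` with values
in `Δ^ab`; the "`ℤ`-linear combinations of `t_x`'s" of p. 35 are formed from these).
[cite: MochizukiAbsTopIII2015, Prop 1.6 (ii) p.35] -/
def sectionDiff (s t : E.Section) (σ : E.gal) : geomAbelianized E :=
  ⟨sectionJ1 s σ * (sectionJ1 t σ)⁻¹, by
    rw [mem_geomAbelianized_iff, map_mul, map_inv, augJ1_sectionJ1, augJ1_sectionJ1, mul_inv_cancel]⟩

/-- Underlying formula. [cite: MochizukiAbsTopIII2015, Prop 1.6 (ii) p.35] -/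
@[simp] theorem coe_sectionDiff (s t : E.Section) (σ : E.gal) :
    (sectionDiff s t σ : PiJ1 E) = sectionJ1 s σ * (sectionJ1 t σ)⁻¹ :=
  rfl

/-- `δ(s, s) = 1`. [cite: MochizukiAbsTopIII2015, Prop 1.6 (ii) p.35] -/
@[simp] theorem sectionDiff_self (s : E.Section) (σ : E.gal) : sectionDiff s s σ = 1 :=
  Subtype.ext (by simp)

/-- **The divisor cocycle** of `D = Σ_i n_i [x_i]` (rational points `x_i` with sections `s_i`) relative
to a base section `s₀`: `σ ↦ ∏_i (t_{x_i}(σ) t₀(σ)⁻¹)^{n_i} ∈ Δ^ab` — the cocycle of the section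
"`t_D`" ("forming the appropriate `ℤ`-linear combination of '`t_x`'s' for `x ∈ Supp(D)`", p. 35)
measured against `d · t₀`; for `deg D = Σ n_i = 0` it does not depend on `s₀`.
[cite: MochizukiAbsTopIII2015, Prop 1.6 (ii) p.35] -/
def divisorCocycle {ι : Type u} [Fintype ι] (n : ι → ℤ) (s : ι → E.Section) (s₀ : E.Section)
    (σ : E.gal) : geomAbelianized E :=
  ∏ i, sectionDiff (s i) s₀ σ ^ n i

/-- The `G`-action on `Δ^ab` through a section (`σ · a := t₀(σ) a t₀(σ)⁻¹`; independent of the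
section since `Δ^ab` is abelian — not proved here). [cite: MochizukiAbsTopIII2015, Prop 1.6 (ii) p.35] -/
def sectionAct (s₀ : E.Section) (σ : E.gal) : geomAbelianized E →* geomAbelianized E :=
  (MulAut.conjNormal (sectionJ1 s₀ σ) : MulAut (geomAbelianized E)).toMonoidHom

/-- Underlying formula. [cite: MochizukiAbsTopIII2015, Prop 1.6 (ii) p.35] -/
@[simp] theorem coe_sectionAct (s₀ : E.Section) (σ : E.gal) (a : geomAbelianized E) :
    (sectionAct s₀ σ a : PiJ1 E) = sectionJ1 s₀ σ * a * (sectionJ1 s₀ σ)⁻¹ :=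
  rfl

/-- **"`t_D` coincides [up to conjugation by `Δ_X`] with the section determined by the identity
element"** in cocycle form: the cocycle `c` (relative to `s₀`) is the coboundary of some
`a ∈ Δ^ab`, `c(σ) = a · (σ·a)⁻¹` — i.e. the section with cocycle `c` is the `a`-conjugate of the base
section. [cite: MochizukiAbsTopIII2015, Prop 1.6 (ii) p.35] -/
def IsPrincipalCocycle (s₀ : E.Section) (c : E.gal → geomAbelianized E) : Prop :=
  ∃ a : geomAbelianized E, ∀ σ, c σ = a * (sectionAct s₀ σ a)⁻¹

/-- The trivial cocycle is principal (`a = 1`). [cite: MochizukiAbsTopIII2015, Prop 1.6 (ii) p.35] -/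
theorem isPrincipalCocycle_one (s₀ : E.Section) : IsPrincipalCocycle s₀ fun _ => 1 :=
  ⟨1, fun σ => by simp⟩

/-- The divisor cocycle of the zero divisor is trivial. [cite: MochizukiAbsTopIII2015, Prop 1.6 (ii) p.35] -/
theorem divisorCocycle_zero {ι : Type u} [Fintype ι] (s : ι → E.Section) (s₀ : E.Section) :
    divisorCocycle (fun _ => (0 : ℤ)) s s₀ = fun _ => 1 := by
  funext σ
  simp [divisorCocycle]

end Jacobian

/-! ### Proposition 1.6 (ii) relative to a model with rational points and divisors -/

/-- A `CurveModel` together with the data Prop. 1.6 (ii) speaks about: the `k`-rational points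
`x ∈ X(k)` (as a predicate on closed points), their sections "`s_x : G_k → Π_X` [well-defined up to
conjugation by `Δ_X`]" (p. 35), and the orders `ord_x : K_X^× → ℤ` of rational functions at closed
points (from which divisors of functions, hence "principal", are DEFINED).  INTERFACE (geometric
data of the intended étale-`π₁` model). [cite: MochizukiAbsTopIII2015, Prop 1.6 (ii) p.35] -/
structure DivisorCurveModel : Type (u + 2) extends CurveModel.{u} where
  /-- `x ∈ X(k)`: the closed point `x` is `k`-rational -/
  IsRationalPt : ∀ U : Curve, Point U → Prop
  /-- "`s_x : G_k → Π_X` for the associated section" of a rational point -/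
  ptSection : ∀ {U : Curve} (x : Point U), IsRationalPt U x → (ext U).Section
  /-- the section lands in (the chosen) decomposition group `D_x` -/
  ptSection_range : ∀ {U : Curve} (x : Point U) (h : IsRationalPt U x),
    (ptSection x h).decompositionGroup = decomp U x
  /-- the order `ord_x : K_U^× → ℤ` of a rational function at the closed point `x` -/
  ord : ∀ {U : Curve}, Point U → ((FunctionField U)ˣ →* Multiplicative ℤ)

namespace DivisorCurveModel

variable (M : DivisorCurveModel.{u})

/-- A divisor `D` on `X` (finitely supported on closed points) is *principal*: `D = div(f)` for some
`f ∈ K_X^×`, i.e. `ord_x(f) = D(x)` at every closed point. [cite: MochizukiAbsTopIII2015, Prop 1.6 (ii) p.35] -/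
def IsPrincipal {X : M.Curve} (D : M.Point X →₀ ℤ) : Prop :=
  ∃ f : (M.FunctionField X)ˣ, ∀ x : M.Point X, Multiplicative.toAdd (M.ord x f) = D x

/-- The divisor cocycle of a divisor `D` with `Supp(D) ⊆ X(k)` (sections `s_x` of the model at the
points of the support, base section `s₀`). [cite: MochizukiAbsTopIII2015, Prop 1.6 (ii) p.35] -/
def divisorCocycleOf {X : M.Curve} (D : M.Point X →₀ ℤ) (hD : ∀ x ∈ D.support, M.IsRationalPt X x)
    (s₀ : (M.ext X).Section) : (M.ext X).gal → geomAbelianized (M.ext X) :=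
  divisorCocycle (ι := ↥D.support) (fun x => D x) (fun x => M.ptSection x.1 (hD x.1 x.2)) s₀

/-- **Prop. 1.6 (ii) (the `d = 0` criterion), relative to `M`**: for `X` a proper curve over a
Kummer-faithful field and a divisor `D` of degree `0` supported on `k`-rational points, the section
`t_D` "coincides [up to conjugation by `Δ_X`] with the section determined by the identity element
`∈ J(k)` if and only if the divisor `D` is principal" — in cocycle form: the divisor cocycle (relative
to any base section `s₀`) is a coboundary iff `D` is principal.  NAMED FACT relative to `M`
(hypothesis `IsKummerFaithful`: TODO(general form), see `KummerFaithful.lean`).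
-- TODO(general form): `t_D : G_k → Π_{J^d}` for `d ≠ 0`.
[cite: MochizukiAbsTopIII2015, Prop 1.6 (ii) p.35] -/
def Prop_1_6_ii (M : DivisorCurveModel.{u}) : Prop :=
  ∀ (X : M.Curve), M.IsScheme X → M.IsProper X → IsKummerFaithful (M.base X) →
    ∀ (D : M.Point X →₀ ℤ) (hD : ∀ x ∈ D.support, M.IsRationalPt X x),
      (∑ x ∈ D.support, D x) = 0 →
        ∀ s₀ : (M.ext X).Section,
          IsPrincipalCocycle s₀ (M.divisorCocycleOf D hD s₀) ↔ M.IsPrincipal D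

end DivisorCurveModel

end Literature.AnabelianGeometry.AbsoluteAnabelian.AbsTopIII
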